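import Literature.AlgebraicGeometry.Resolution.KedlayaEtaleCoversProofs
import Literature.AlgebraicGeometry.Resolution.ResolutionProjectiveReduction
import Literature.AlgebraicGeometry.Resolution.QuasiProjectiveReduction
import Literature.AlgebraicGeometry.Resolution.AlterationsLemma32
import Literature.AlgebraicGeometry.Resolution.AlterationsNormalizationReduction
import Mathlib.RingTheory.LocalProperties.IntegrallyClosed
import HarnessLib

/-!
# Crux `CleanCovers.CoverResolution` (stmt-ResolutionOfSingularities-15104), line `strategy-split`
# (v2.3): stub `locallyResolvableNormal_of_pointResolutionNormal`

Route `ResolutionOfSingularities/CleanCovers`. A *Kedlaya cover* is an integral scheme `X` with a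
finite surjective `f : X → ℙⁿ_k` (`k` perfect of characteristic `p`) which is étale over the chart
`A := D₊(xₙ)`; it is *normal* when all its local rings are integrally closed. The pointwise local
stub **L⁰_pt** asks: on every normal Kedlaya cover, every point `x` with `f x ∉ A` has an open
neighbourhood `U ∋ x` with `Scheme.HasResolution U`. This file PROVES that L⁰_pt implies
**LocResNormal** — every point of every normal integral separated scheme of finite type over a
perfect field of positive characteristic has a resolvable open neighbourhood.

Proof. Given `g : X → Spec k` (all stalks of `X` integrally closed) and `x ∈ X`: (1) pick an affine
open `V ∋ x` (`exists_isAffineOpen_mem_and_subset`); `V` is integral and of finite type over `k`.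
(2) Embed `ρ : V ↪ ℙᵐ_k` (`ChowLemmaProof.exists_immersion_projectiveSpace`, Görtz–Wedhorn
§(12.15)) and take the projective closure `V ↪ X̄ ↪ ℙᵐ_k` (`exists_projectiveClosure`: `j : V → X̄`
an open immersion, `c : X̄ → ℙᵐ_k` a closed immersion, `X̄` integral). (3) NORMALISE: the
normalisation `ν : X̄^ν → X̄` is finite (E. Noether, `isFinite_normalizationι …
NoetherFiniteIntegralClosure_holds`), so `ν ≫ c : X̄^ν → ℙᵐ_k` is finite and Kedlaya's theorem in
the tree's proved form (`Kedlaya2004_finite_etale_off_hyperplane_holds`, Kedlaya 2005 Thm. 1)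
makes the normal integral `X̄^ν` (`isIntegrallyClosed_stalk_normalization`) a Kedlaya cover
`f : X̄^ν → ℙⁿ_k`. (4) `ν` is an isomorphism over the affine open `U₀ := j(V) ≅ V` of `X̄`: the
stalks of `X̄` at points of `U₀` are stalks of `X`, hence integrally closed, so `Γ(X̄, U₀)` is
integrally closed (`isIntegrallyClosed_sections_of_stalk_of_mem`, a local property) and
`isIso_normalizationι_morphismRestrict` applies; this yields an open immersion
`φ : V ≅ U₀ ≅ ν⁻¹(U₀) ↪ X̄^ν`. (5) The point `φ x` of `X̄^ν` has a resolvable open neighbourhood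
`W`: over the chart, `f⁻¹(A)` is étale over the regular `A`
(`smooth_isSeparated_quasiCompact_isRegular_opens_projectiveSpace`), hence regular
(`Scheme.IsRegular.of_smooth`), hence its own resolution; off the chart L⁰_pt applies. (6) Pull
back along the open immersion `φ ∣_ W` (`Scheme.HasResolution.of_isOpenImmersion`) to
`φ⁻¹(W) ∋ x`, an open of `V`, and push it into `X` along `V.ι` (`Scheme.Hom.isoImage`,
`Scheme.HasResolution.of_iso`). No named fact is taken as a hypothesis.
-/

set_option linter.dupNamespace false -- mandated namespace of this single-conjunct summit

noncomputable section

namespace Summit.ResolutionOfSingularities.ResolutionOfSingularities.Theorems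

open CategoryTheory AlgebraicGeometry TopologicalSpace
open Literature.AlgebraicGeometry.Resolution

universe u

/-! ## Sections over an affine open all of whose local rings are integrally closed -/

/-- If the local rings of the integral scheme `Y` at all points of a non-empty affine open `V` are
integrally closed, then so is the ring of sections `Γ(Y, V)`: its localisations at maximal ideals
are local rings of `Y` at points of `V` (`IsAffineOpen.isLocalization_stalk'`), and being
integrally closed is a local property (`IsIntegrallyClosed.of_localization_maximal`). [folklore] -/
theorem isIntegrallyClosed_sections_of_stalk_of_mem {Y : Scheme.{u}} [IsIntegral Y] {V : Y.Opens}
    (hV : IsAffineOpen V) [Nonempty V]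
    (hY : ∀ y : Y, y ∈ V → IsIntegrallyClosed (Y.presheaf.stalk y)) :
    IsIntegrallyClosed Γ(Y, V) := by
  refine IsIntegrallyClosed.of_localization_maximal fun 𝔭 _ h𝔭 => ?_
  let q : PrimeSpectrum Γ(Y, V) := ⟨𝔭, h𝔭.isPrime⟩
  have hq : hV.fromSpec q ∈ V := hV.range_fromSpec.le ⟨q, rfl⟩
  letI := TopCat.Presheaf.algebra_section_stalk Y.presheaf (⟨hV.fromSpec q, hq⟩ : V)
  haveI : IsLocalization.AtPrime (Y.presheaf.stalk (hV.fromSpec q)) 𝔭 :=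
    hV.isLocalization_stalk' q hq
  haveI := hY (hV.fromSpec q) hq
  exact IsIntegrallyClosed.of_equiv (IsLocalization.algEquiv 𝔭.primeCompl
    (Y.presheaf.stalk (hV.fromSpec q)) (Localization.AtPrime 𝔭)).toRingEquiv

/-! ## The stub -/

/-- **Stub `locallyResolvableNormal_of_pointResolutionNormal`** (line `strategy-split` v2.3 of
`CoverResolution`): pointwise resolvable neighbourhoods over the hyperplane at infinity on NORMAL
Kedlaya covers (`f : X → ℙⁿ_k` finite surjective, étale over `D₊(xₙ)`, `X` integral with
integrally closed local rings, `k` perfect of characteristic `p`) give pointwise resolvable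
neighbourhoods on EVERY normal integral separated scheme of finite type over a perfect field of
characteristic `p`. Proof: an affine open neighbourhood `V ∋ x` embeds into some `ℙᵐ_k`
(Görtz–Wedhorn §(12.15)) with projective closure `X̄`; the normalisation `X̄^ν` (finite over `X̄` by
E. Noether) is a normal Kedlaya cover of some `ℙⁿ_k` (Kedlaya 2005, Thm. 1, proved in the tree as
`Kedlaya2004_finite_etale_off_hyperplane_holds`); `X̄^ν → X̄` is an isomorphism over the normal
affine open `V ⊆ X̄`, whence an open immersion `φ : V ↪ X̄^ν`; over the chart the cover is étale
over a regular scheme, hence regular, and off the chart the hypothesis applies, so `φ x` has a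
resolvable open neighbourhood `W`; finally `V.ι(φ⁻¹ W)` is the sought open of `X` (resolutions
transport along open immersions and isomorphisms). [cite: Kedlaya2004, Thm. 1] -/
theorem stub_locallyResolvableNormal_of_pointResolutionNormal : (∀ p : ℕ, p.Prime → ∀ (k : Type) [Field k] [CharP k p] [PerfectField k] (n : ℕ) (X : AlgebraicGeometry.Scheme.{0}) (f : X ⟶ (Literature.AlgebraicGeometry.Motives.projectiveSpace n k).left), AlgebraicGeometry.IsIntegral X → AlgebraicGeometry.IsFinite f → Function.Surjective f.base → (letI := MvPolynomial.gradedAlgebra (σ := Fin (n + 1)) (R := k); AlgebraicGeometry.Etale (f ∣_ (AlgebraicGeometry.Proj.basicOpen (MvPolynomial.homogeneousSubmodule (Fin (n + 1)) k) (MvPolynomial.X (Fin.last n))))) → (∀ x : X, IsIntegrallyClosed (X.presheaf.stalk x)) → ∀ x : X, (letI := MvPolynomial.gradedAlgebra (σ := Fin (n + 1)) (R := k); f.base x ∉ AlgebraicGeometry.Proj.basicOpen (MvPolynomial.homogeneousSubmodule (Fin (n + 1)) k) (MvPolynomial.X (Fin.last n))) → ∃ U : X.Opens, x ∈ U ∧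 Literature.AlgebraicGeometry.Resolution.Scheme.HasResolution (U : AlgebraicGeometry.Scheme.{0})) → (∀ p : ℕ, p.Prime → ∀ (k : Type) [Field k] [CharP k p] [PerfectField k] (X : AlgebraicGeometry.Scheme.{0}) (g : X ⟶ AlgebraicGeometry.Spec (.of k)), AlgebraicGeometry.IsSeparated g → AlgebraicGeometry.LocallyOfFiniteType g → AlgebraicGeometry.QuasiCompact g → AlgebraicGeometry.IsIntegral X → (∀ x : X, IsIntegrallyClosed (X.presheaf.stalk x)) → ∀ x : X, ∃ U : X.Opens, x ∈ U ∧ Literature.AlgebraicGeometry.Resolution.Scheme.HasResolution (U : AlgebraicGeometry.Scheme.{0})) := by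
  intro hL p hp k _ _ _ X g _ hl _ hi hn x
  -- (1) an affine open neighbourhood `V ∋ x`; it is integral and of finite type over `k`
  obtain ⟨V, hV, hxV, -⟩ := exists_isAffineOpen_mem_and_subset (U := ⊤) (Opens.mem_top x)
  haveI : IsAffine (V : Scheme.{0}) := hV
  haveI : Nonempty (V : Scheme.{0}) := ⟨(⟨x, hxV⟩ : V)⟩
  haveI : IsIntegral (V : Scheme.{0}) := isIntegral_of_isOpenImmersion V.ι
  -- (2) an immersion `ρ : V ↪ ℙᵐ_k` and the projective closure `V ↪ Xbar ↪ ℙᵐ_k`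
  obtain ⟨m, ρ, hρ, -⟩ := ChowLemmaProof.exists_immersion_projectiveSpace k (V.ι ≫ g)
  haveI := hρ
  obtain ⟨Xbar, j, c, hXbar, hj, hc, -, -⟩ := exists_projectiveClosure ρ
  haveI := hXbar
  haveI := hj
  haveI := hc
  -- (3) the normalisation `ν : Xbar^ν → Xbar` is finite (E. Noether), so Kedlaya's theorem makes
  -- the normal integral `Xbar^ν` a Kedlaya cover `f : Xbar^ν → ℙⁿ_k`
  haveI : IsProper (Literature.AlgebraicGeometry.Motives.projectiveSpace m k).hom :=
    Literature.AlgebraicGeometry.Motives.isProper_projectiveSpace m k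
  let gbar : Xbar ⟶ Spec (.of k) := c ≫ (Literature.AlgebraicGeometry.Motives.projectiveSpace m k).hom
  haveI : LocallyOfFiniteType gbar := inferInstance
  haveI hνfin : IsFinite (normalizationι Xbar) :=
    isFinite_normalizationι Xbar NoetherFiniteIntegralClosure_holds gbar
  obtain ⟨n, f, -, hfin, hsurj, het⟩ :=
    Kedlaya2004_finite_etale_off_hyperplane_holds p hp k m (normalization Xbar)
      (normalizationι Xbar ≫ c) inferInstance inferInstance
  -- (4) `ν` is an isomorphism over the normal affine open `U₀ := j(V)` of `Xbar`, whence an open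
  -- immersion `φ : V ≅ U₀ ≅ ν⁻¹ U₀ ↪ Xbar^ν`
  have hU₀ : IsAffineOpen j.opensRange := isAffineOpen_opensRange j
  have hx₀ : j.base ⟨x, hxV⟩ ∈ j.opensRange := ⟨⟨x, hxV⟩, rfl⟩
  haveI : Nonempty j.opensRange := ⟨⟨_, hx₀⟩⟩
  have hnU : ∀ y : Xbar, y ∈ j.opensRange → IsIntegrallyClosed (Xbar.presheaf.stalk y) := by
    rintro _ ⟨v, rfl⟩
    haveI : IsIntegrallyClosed ((V : Scheme.{0}).presheaf.stalk v) :=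
      IsIntegrallyClosed.of_equiv (h := hn v.1) (asIso (V.ι.stalkMap v)).commRingCatIsoToRingEquiv
    exact IsIntegrallyClosed.of_equiv (asIso (j.stalkMap v)).commRingCatIsoToRingEquiv.symm
  haveI hiso : IsIso (normalizationι Xbar ∣_ j.opensRange) :=
    isIso_normalizationι_morphismRestrict Xbar hU₀ ⟨_, hx₀⟩
      (isIntegrallyClosed_sections_of_stalk_of_mem hU₀ hnU)
  let φ : (V : Scheme.{0}) ⟶ normalization Xbar :=
    j.isoOpensRange.hom ≫ inv (normalizationι Xbar ∣_ j.opensRange) ≫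
      (normalizationι Xbar ⁻¹ᵁ j.opensRange).ι
  haveI hφ : IsOpenImmersion φ := inferInstance
  -- (5) a resolvable open neighbourhood `W ∋ φ x` in `Xbar^ν`: over the chart `f⁻¹(D₊(xₙ))` is
  -- étale over a regular locally Noetherian scheme, hence regular; off the chart, the hypothesis
  obtain ⟨W, hxW, hW⟩ : ∃ W : (normalization Xbar).Opens, φ.base ⟨x, hxV⟩ ∈ W ∧
      Scheme.HasResolution (W : Scheme.{0}) := by
    letI := MvPolynomial.gradedAlgebra (σ := Fin (n + 1)) (R := k)
    set A : (Literature.AlgebraicGeometry.Motives.projectiveSpace n k).left.Opens :=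
      AlgebraicGeometry.Proj.basicOpen (MvPolynomial.homogeneousSubmodule (Fin (n + 1)) k)
        (MvPolynomial.X (Fin.last n))
    haveI hAet : Etale (f ∣_ A) := het
    by_cases hx : f.base (φ.base ⟨x, hxV⟩) ∈ A
    · haveI : IsProper (Literature.AlgebraicGeometry.Motives.projectiveSpace n k).hom :=
        Literature.AlgebraicGeometry.Motives.isProper_projectiveSpace n k
      haveI : IsLocallyNoetherian (Literature.AlgebraicGeometry.Motives.projectiveSpace n k).left :=
        LocallyOfFiniteType.isLocallyNoetherian
          (Literature.AlgebraicGeometry.Motives.projectiveSpace n k).hom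
      have hAreg : Scheme.IsRegular (A : Scheme.{0}) :=
        (smooth_isSeparated_quasiCompact_isRegular_opens_projectiveSpace n A).2.2.2
      have hfAreg : Scheme.IsRegular ((f ⁻¹ᵁ A : (normalization Xbar).Opens) : Scheme.{0}) :=
        Scheme.IsRegular.of_smooth (f ∣_ A) hAreg
      exact ⟨f ⁻¹ᵁ A, hx, hfAreg.hasResolution⟩
    · exact hL p hp k n (normalization Xbar) f inferInstance hfin hsurj het
        (isIntegrallyClosed_stalk_normalization Xbar) _ hx
  -- (6) pull back along the open immersion `φ ∣_ W : φ⁻¹ W → W`, push into `X` along `V.ι`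
  have hW' : Scheme.HasResolution ((φ ⁻¹ᵁ W : (V : Scheme.{0}).Opens) : Scheme.{0}) :=
    hW.of_isOpenImmersion (φ ∣_ W)
  exact ⟨V.ι ''ᵁ (φ ⁻¹ᵁ W), ⟨⟨x, hxV⟩, hxW, rfl⟩,
    Scheme.HasResolution.of_iso (V.ι.isoImage (φ ⁻¹ᵁ W)).hom hW'⟩

end Summit.ResolutionOfSingularities.ResolutionOfSingularities.Theorems

end
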